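import Literature.Computability.Complexity.TVCheckerStage
import Literature.Computability.Complexity.UnaryLeBinary
import HarnessLib

/-!
# `FP` bricks for the downward checker of Trevisan–Vadhan's language, IV: the stage conjuncts, one
# run, sixty-four runs — the verdict on the core record is `checksV` of the analysis

Literature / complexity — fourth machine layer of the downward checker (sequel of `TVCheckerStage.lean`;
analysis `TVDownwardCheckerAnalysis.lean`). A run of the membership checker (`ChainCheck.Chain.checksV`)
from stage `i` with `m' = mlen n - i` stages accepts the word `w` iff (the unrolled form
`checksV_succ_eq_true_iff`) bit `jOf n w` of the rule's value `E₀` is `1`, every later rule value `Eₛ`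
equals the previous interpolant at the previous challenge, and the universal matrix at the last point
equals the last such claim; with no stage (`i = mlen n`) it accepts iff bit `jOf n w` of the matrix at
`xOf n w` is `1`. This file realizes exactly that conjunction:

* `TVChk.uvalF` (a small binary numeral in unary, by a counted fold of threshold tests `unLeBinFn`),
  `TVChk.selBitsS` / `jIxS` (the selector `jOf n w` in unary: `remFn` for `mod blk n`), `TVChk.bitAtS E`
  (bit `jOf n w` of the value delivered by `E`; `bitAtS_apply`);
* `TVChk.matS` (the matrix brick `TVBrick.matrixF` at the point of the stage), **`TVChk.conjS acc`** — the
  conjunct of stage `s ≤ m'` — and its values `conjS_apply_zero/_mid/_last/_nil`;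
* `TVChk.runF acc` (the `andOpF`-fold of the `m' + 1` conjuncts of run `t`), **`TVChk.chkCoreF acc`** (the
  fold over the `64` runs) and **`TVChk.chkCoreF_apply`**: on the core record of a canonical word the
  verdict is `[allBelow 64 (t ↦ (tvChain n hn).checksV (node n) (stageDeg n) O good m' i (xOf n w) (coins of run t))]`,
  `O` the level oracle presented by `acc`, `good` = "bit `jOf n w` is `1`"; `chkCoreF_apply_zero` for
  `m' = 0`.

Everything is proved; definitions are `FP` string functions (no named facts, D-0026).

## References

* C. Lund, L. Fortnow, H. Karloff, N. Nisan, J. ACM 39 (1992), §3 [LundEtAl1992].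
* R. Santhanam, SIAM J. Comput. 39 (2009), Lemma 12 [Santhanam2009].
* S. Arora, B. Barak, CUP 2009, §8.3.3, §1.3 [AroraBarakCC2009].
* L. Trevisan, S. Vadhan, Comput. Complexity 16 (2007), Thm. 4.3, Thm. 5.4 [TrevisanVadhan2007].
-/

noncomputable section

namespace Literature.Computability.Complexity

namespace TVChk

open _root_.Computability Polynomial Finset Brick Plumb GF2Str HardLangM TVBrick QBFUniv SelfCorrect
  Literature.InformationTheory.Coding

/-! ### A small binary numeral in unary -/

/-- The threshold piece on `⟨⟨bin v, 1ᴮ⟩, 1ᵘ⟩`: `[true]` if `u + 1 ≤ v`, else `ε`. [folklore] -/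
def uvalPieceF : List Bool → List Bool :=
  iteFn (unLeBinFn ∘ fanoutFn (List.cons true ∘ sndF) (fstF ∘ fstF)) (fun _ => [true]) (fun _ => [])

/-- `uvalPieceF ∈ FP`. [folklore] -/
theorem uvalPieceF_mem_FP : uvalPieceF ∈ FP :=
  iteFn_mem_FP (comp_mem_FP unLeBinFn_mem_FP (fanoutFn_mem_FP (comp_mem_FP (cons_mem_FP true) sndF_mem_FP)
    (comp_mem_FP fstF_mem_FP fstF_mem_FP))) (const_mem_FP _) (const_mem_FP _)

/-- Value of the threshold piece. [folklore] -/
theorem uvalPieceF_apply (v : ℕ) (b : List Bool) (u : ℕ) :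
    uvalPieceF (boolPair (boolPair (encodeNat v) b) (ones u)) = if u + 1 ≤ v then [true] else [] := by
  have hc : (unLeBinFn ∘ fanoutFn (List.cons true ∘ sndF) (fstF ∘ fstF)) (boolPair (boolPair (encodeNat v) b) (ones u)) =
      [decide (u + 1 ≤ v)] := by
    simp only [Function.comp_apply, fanoutFn_apply, sndF_boolPair, fstF_boolPair, unLeBinFn_boolPair, List.length_cons, ones,
      List.length_replicate]
  rw [uvalPieceF, iteFn_apply hc]
  by_cases h : u + 1 ≤ v
  · rw [if_pos h, decide_eq_true h, if_pos rfl]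
  · rw [if_neg h, decide_eq_false h, if_neg Bool.false_ne_true]

/-- The fold of threshold pieces counts up to `min v k`. [folklore] -/
theorem ccat_uval (v : ℕ) : ∀ k, ccat (fun u => if u + 1 ≤ v then [true] else []) k = ones (min v k)
  | 0 => by simp [ones]
  | k + 1 => by
    rw [ccat_succ, ccat_uval v k]
    by_cases h : k + 1 ≤ v
    · rw [if_pos h, Nat.min_eq_right (by omega : k ≤ v), Nat.min_eq_right h]; simp [ones, List.replicate_succ']
    · rw [if_neg h, List.append_nil, Nat.min_eq_left (by omega : v ≤ k), Nat.min_eq_left (by omega : v ≤ k + 1)]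

/-- **A binary numeral in unary**, on `⟨bin v, b⟩` with `v ≤ |b|`: `1ᵛ`. [folklore] -/
def uvalF : List Bool → List Bool :=
  sndPow 2 ∘ foldLoop appF (clipF 1 uvalPieceF) X ∘ fanoutFn (fun z => z) (fanoutFn (lenBinF ∘ sndF) (fun _ => boolPair [] []))

/-- `uvalF ∈ FP`. [folklore] -/
theorem uvalF_mem_FP : uvalF ∈ FP :=
  comp_mem_FP (sndPow_mem_FP 2) (comp_mem_FP (foldLoop_clipF_mem_FP 1 appF_mem_FP length_appF_le uvalPieceF_mem_FP _)
    (fanoutFn_mem_FP (PolyTimeComputable.id _) (fanoutFn_mem_FP (comp_mem_FP lenBinF_mem_FP sndF_mem_FP) (const_mem_FP _))))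

/-- **Value of `uvalF`.** [folklore] -/
theorem uvalF_apply {v : ℕ} {b : List Bool} (hv : v ≤ b.length) : uvalF (boolPair (encodeNat v) b) = ones v := by
  have hk : b.length ≤ (X : Polynomial ℕ).eval (boolPair (encodeNat v) b).length := by
    simp only [eval_X, length_boolPair]; omega
  have hinit : (fanoutFn (fun z => z) (fanoutFn (lenBinF ∘ sndF) (fun _ => boolPair [] []))) (boolPair (encodeNat v) b) =
      boolPair (boolPair (encodeNat v) b) (boolPair (encodeNat b.length) (boolPair (ones 0) [])) := by
    simp [ones]
  rw [uvalF, Function.comp_apply, Function.comp_apply, hinit, foldLoop_apply _ _ hk, sndPow_succ_boolPair, sndPow_succ_boolPair,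
    sndPow_zero_boolPair, foldAcc_clipF (fun u _ _ => by rw [uvalPieceF_apply]; split_ifs <;> simp), foldAcc_appF, List.nil_append]
  rw [show (fun j => uvalPieceF (boolPair (boolPair (encodeNat v) b) (ones (0 + j)))) = fun u => if u + 1 ≤ v then [true] else []
    from funext fun u => by rw [Nat.zero_add, uvalPieceF_apply], ccat_uval, Nat.min_eq_left hv]

/-! ### The selector `jOf n w` in unary, and a bit of a field value -/

/-- `1^{blk n}` of a stage record (`|f| - 1`). [folklore] -/
def blkS : List Bool → List Bool := dropFn ∘ fanoutFn (fun _ => [true]) qF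

/-- **The selector bits** `(w ⇂ ptLen n) ↾ blk n` of the word. [cite: TrevisanVadhan2007, Thm. 4.3 (proof: "`j` takes `log n` bits")] -/
def selBitsS : List Bool → List Bool := takeFn ∘ fanoutFn blkS (dropFn ∘ fanoutFn ptLenOf qW)

/-- **The selector `jOf n w`** in unary: `(⟦selector bits⟧ mod blk n)` (`remFn`, then `uvalF` with budget
`blk n`). [cite: TrevisanVadhan2007, Thm. 4.3 (proof)] -/
def jIxS : List Bool → List Bool := uvalF ∘ fanoutFn (remFn ∘ fanoutFn selBitsS (lenBinF ∘ blkS)) blkS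

/-- These are in `FP`. [folklore] -/
theorem jIx_mem_FP : blkS ∈ FP ∧ selBitsS ∈ FP ∧ jIxS ∈ FP := by
  have hb : blkS ∈ FP := comp_mem_FP dropFn_mem_FP (fanoutFn_mem_FP (const_mem_FP _) q_mem_FP.2.2.2.2.2.2.2.1)
  have hs : selBitsS ∈ FP := comp_mem_FP takeFn_mem_FP (fanoutFn_mem_FP hb (comp_mem_FP dropFn_mem_FP
    (fanoutFn_mem_FP ptLenOf_mem_FP q_mem_FP.1)))
  exact ⟨hb, hs, comp_mem_FP uvalF_mem_FP (fanoutFn_mem_FP (comp_mem_FP remFn_mem_FP (fanoutFn_mem_FP hs (comp_mem_FP lenBinF_mem_FP hb))) hb)⟩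

/-- **The selector brick computes `jOf n w`** (in unary). [cite: TrevisanVadhan2007, Thm. 4.3 (proof)] -/
theorem jIxS_apply (w r e : List Bool) (n i m' Z t s : ℕ) :
    jIxS (stRec (coreRec w r e n i m' Z (modStr (Mof n))) t s) = ones (jOf n w).val := by
  set S := stRec (coreRec w r e n i m' Z (modStr (Mof n))) t s with hSdef
  obtain ⟨hW, -, -, -, -, -, -, hF, -, -⟩ := q_apply w r e n i m' Z (modStr (Mof n)) t s
  have hb : blkS S = (modStr (Mof n)).drop 1 := by
    rw [blkS, Function.comp_apply, fanoutFn_apply, hF, dropFn_boolPair, List.length_singleton]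
  have hbl : ((modStr (Mof n)).drop 1).length = blk n := by
    rw [List.length_drop, (modStr_top _).1]; rfl
  have hsel : selBitsS S = (w.drop (ptLen n)).take (blk n) := by
    rw [selBitsS, Function.comp_apply, fanoutFn_apply, hb, Function.comp_apply, fanoutFn_apply, hW, dropFn_boolPair, hSdef,
      length_ptLenOf, takeFn_boolPair, hbl]
  rw [jIxS, Function.comp_apply, fanoutFn_apply, Function.comp_apply, fanoutFn_apply, hsel, Function.comp_apply, hb, lenBinF_apply,
    hbl, remFn_boolPair, bitsToNat_encodeNat, uvalF_apply (by rw [hbl]; exact (Nat.mod_lt _ (blk_pos n)).le)]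
  rfl

/-- An entry of a list as the head of a suffix. [folklore] -/
private theorem headD_drop_eq_getD (l : List Bool) (j : ℕ) : (l.drop j).headD false = l.getD j false := by
  induction l generalizing j with
  | nil => simp
  | cons b l ih =>
    cases j with
    | zero => simp
    | succ j => rw [List.drop_succ_cons, List.getD_cons_succ]; exact ih j

/-- **Bit `jOf n w` of the value delivered by `E`.** [cite: TrevisanVadhan2007, Thm. 4.3 (proof: "`F_{h(n,i)}(x, j)` is the `j`'th bit of `f_{n,i}(x)`")] -/
def bitAtS (E : List Bool → List Bool) : List Bool → List Bool := HashBricks.headBitFn ∘ dropFn ∘ fanoutFn jIxS E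

/-- `bitAtS E ∈ FP` for `E ∈ FP`. [folklore] -/
theorem bitAtS_mem_FP {E : List Bool → List Bool} (hE : E ∈ FP) : bitAtS E ∈ FP :=
  comp_mem_FP HashBricks.headBitFn_mem_FP (comp_mem_FP dropFn_mem_FP (fanoutFn_mem_FP jIx_mem_FP.2.2 hE))

/-- The predicate `good` of the analysis: bit `j` of a field value. [folklore] -/
def goodBit (n : ℕ) (j : Fin (blk n)) (v : K n) : Bool := encF (Mof n) v j

/-- **Value of `bitAtS`**: with `E` delivering the bits of `v`, the bit `goodBit n (jOf n w) v`. [folklore] -/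
theorem bitAtS_apply {E : List Bool → List Bool} (w r e : List Bool) (n i m' Z t s : ℕ) {v : K n}
    (hE : E (stRec (coreRec w r e n i m' Z (modStr (Mof n))) t s) = bits (Mof n) v) :
    bitAtS E (stRec (coreRec w r e n i m' Z (modStr (Mof n))) t s) = [goodBit n (jOf n w) v] := by
  rw [bitAtS, Function.comp_apply, Function.comp_apply, fanoutFn_apply, jIxS_apply, hE, dropFn_boolPair, HashBricks.headBitFn_apply,
    headD_drop_eq_getD, goodBit, bits]
  simp only [ones, List.length_replicate, List.getD_eq_getElem?_getD, List.getElem?_ofFn, Fin.eta, dif_pos (jOf n w).isLt,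
    Option.getD_some]

/-! ### The matrix at the point of the stage; the conjuncts -/

/-- **The matrix brick at the point of the stage**: `matrixF ⟨Pₛ, ⟨1ⁿ, f⟩⟩`. [cite: TrevisanVadhan2007, Lemma 4.1 (i)] -/
def matS : List Bool → List Bool := matrixF ∘ fanoutFn pointF (fanoutFn qN qF)

/-- `matS ∈ FP`. [folklore] -/
theorem matS_mem_FP : matS ∈ FP :=
  comp_mem_FP matrixF_mem_FP (fanoutFn_mem_FP pointF_mem_FP (fanoutFn_mem_FP q_mem_FP.2.2.2.1 q_mem_FP.2.2.2.2.2.2.2.1))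

/-- **Value of the matrix brick** (`s ≤ m'`): the bits of the universal matrix at the point of the stage. [cite: TrevisanVadhan2007, Lemma 4.1 (i)] -/
theorem matS_apply {n : ℕ} (hn : 0 < n) {w : List Bool} (hw : ptLen n ≤ w.length) (r e : List Bool) {i m' Z t s : ℕ}
    (hs : s ≤ m') (him : i + m' ≤ mlen n) (hr : (t * m' + m') * blk n ≤ r.length) :
    matS (stRec (coreRec w r e n i m' Z (modStr (Mof n))) t s) =
      bits (Mof n) (MvPolynomial.eval ((tvChain n hn).pointSeq i (xOf n w) (runCoins n r t m') s) (matrixPoly (K n) n)) := by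
  obtain ⟨-, -, -, hN, -, -, -, hF, -, -⟩ := q_apply w r e n i m' Z (modStr (Mof n)) t s
  rw [matS, Function.comp_apply, fanoutFn_apply, fanoutFn_apply, pointF_apply hn hw r e hs him hr, hN, hF, ← ctxX,
    ← List.append_nil (ptBits n _), matrixF_apply]

/-- **The conjunct of stage `s`** of a run (`s ≤ m'`): for `s < m'`, bit `jOf n w` of `E₀` (`s = 0`) resp.
`[Eₛ = previous claim]` (`s ≥ 1`); for `s = m'`, bit `jOf n w` of the matrix (`m' = 0`) resp.
`[matrix = previous claim]` (`m' ≥ 1`). [cite: LundEtAl1992, §3] [cite: Santhanam2009, Lemma 12] -/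
def conjS (acc : List Bool → List Bool) : List Bool → List Bool :=
  iteFn (ltLenF ∘ fanoutFn qS qM)
    (iteFn (isNilFn ∘ qS) (bitAtS (ES acc)) (eqPairFn ∘ fanoutFn (ES acc) (prevS acc)))
    (iteFn (isNilFn ∘ qM) (bitAtS matS) (eqPairFn ∘ fanoutFn matS (prevS acc)))

/-- `conjS acc ∈ FP` for `acc ∈ FP`. [folklore] -/
theorem conjS_mem_FP {acc : List Bool → List Bool} (hacc : acc ∈ FP) : conjS acc ∈ FP := by
  obtain ⟨-, -, hE, -, hP⟩ := rule_mem_FP hacc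
  obtain ⟨-, -, -, -, -, hM, -, -, -, hS⟩ := q_mem_FP
  exact iteFn_mem_FP (comp_mem_FP ltLenF_mem_FP (fanoutFn_mem_FP hS hM))
    (iteFn_mem_FP (comp_mem_FP isNilFn_mem_FP hS) (bitAtS_mem_FP hE) (comp_mem_FP eqPairFn_mem_FP (fanoutFn_mem_FP hE hP)))
    (iteFn_mem_FP (comp_mem_FP isNilFn_mem_FP hM) (bitAtS_mem_FP matS_mem_FP) (comp_mem_FP eqPairFn_mem_FP (fanoutFn_mem_FP matS_mem_FP hP)))

/-- `bitAtS E` is one-bit. [folklore] -/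
theorem oneBit_bitAtS (E : List Bool → List Bool) : OneBit (bitAtS E) := fun z =>
  ⟨_, by rw [bitAtS, Function.comp_apply, Function.comp_apply, HashBricks.headBitFn_apply]⟩

/-- An equality test is one-bit. [folklore] -/
theorem oneBit_eqPair (A B : List Bool → List Bool) : OneBit (eqPairFn ∘ fanoutFn A B) := fun z =>
  ⟨_, by rw [Function.comp_apply, fanoutFn_apply, eqPairFn_boolPair]⟩

/-- `conjS` is one-bit. [folklore] -/
theorem oneBit_conjS (acc : List Bool → List Bool) : OneBit (conjS acc) :=
  OneBit.ite (oneBit_ltLenF.comp _) (OneBit.ite (oneBit_isNilFn.comp _) (oneBit_bitAtS _) (oneBit_eqPair _ _))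
    (OneBit.ite (oneBit_isNilFn.comp _) (oneBit_bitAtS _) (oneBit_eqPair _ _))

section ConjValues

variable {n : ℕ} (hn : 0 < n) (acc : List Bool → List Bool) {w : List Bool} (hw : ptLen n ≤ w.length) (r e : List Bool)
  {i m' t : ℕ} (him : i + m' = mlen n) (hr : (t * m' + m') * blk n ≤ r.length)

/-- Abbreviation: the chain, nodes, degrees and level oracle of the analysis, instantiated. [folklore] -/
def checksOf (n : ℕ) (hn : 0 < n) (acc : List Bool → List Bool) (e w r : List Bool) (i m' t : ℕ) : Bool :=
  (tvChain n hn).checksV (node n) (stageDeg n) (levelO acc e n) (goodBit n (jOf n w)) m' i (xOf n w) fun s => runCoins n r t m' s.val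

/-- The tests deciding the branches of `conjS`. [folklore] -/
theorem conj_tests (w r e : List Bool) (n i m' Z : ℕ) (f : List Bool) (t s : ℕ) :
    (ltLenF ∘ fanoutFn qS qM) (stRec (coreRec w r e n i m' Z f) t s) = [decide (s < m')] ∧
    (isNilFn ∘ qS) (stRec (coreRec w r e n i m' Z f) t s) = [decide (s = 0)] ∧
    (isNilFn ∘ qM) (stRec (coreRec w r e n i m' Z f) t s) = [decide (m' = 0)] := by
  obtain ⟨-, -, -, -, -, hM, -, -, -, hS⟩ := q_apply w r e n i m' Z f t s
  refine ⟨?_, ?_, ?_⟩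
  · rw [Function.comp_apply, fanoutFn_apply, hS, hM, ltLenF_boolPair]; simp [ones]
  · rw [Function.comp_apply, hS, isNilFn]; simp [ones, List.replicate_eq_nil_iff]
  · rw [Function.comp_apply, hM, isNilFn]; simp [ones, List.replicate_eq_nil_iff]

include hn hw him hr in
/-- **The conjunct of stage `0 < m'`**: bit `jOf n w` of the rule's value `E₀`. [cite: LundEtAl1992, §3] -/
theorem conjS_apply_zero (hm : 0 < m') :
    conjS acc (stRec (coreRec w r e n i m' (pre n + mlen n - i) (modStr (Mof n))) t 0) =
      [goodBit n (jOf n w) ((tvChain n hn).c i (xOf n w)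
        (((tvChain n hn).claimPoly (node n) (stageDeg n) (levelO acc e n) i (xOf n w)).eval 0)
        (((tvChain n hn).claimPoly (node n) (stageDeg n) (levelO acc e n) i (xOf n w)).eval 1))] := by
  obtain ⟨h1, h2, -⟩ := conj_tests w r e n i m' (pre n + mlen n - i) (modStr (Mof n)) t 0
  rw [conjS, iteFn_apply h1, decide_eq_true hm, if_pos rfl, iteFn_apply h2, decide_eq_true rfl, if_pos rfl]
  have hE := ES_apply hn acc hw r e (s := 0) him hm hr
  simp only [Nat.add_zero, ChainCheck.Chain.pointSeq_zero] at hE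
  exact bitAtS_apply w r e n i m' _ t 0 hE

include hn hw him hr in
/-- **The conjunct of stage `1 ≤ s < m'`**: `[Eₛ = q_{s-1}(ρ_{s-1})]`. [cite: LundEtAl1992, §3] -/
theorem conjS_apply_mid {s : ℕ} (hs1 : 1 ≤ s) (hs : s < m') :
    conjS acc (stRec (coreRec w r e n i m' (pre n + mlen n - i) (modStr (Mof n))) t s) =
      [decide ((tvChain n hn).c (i + s) ((tvChain n hn).pointSeq i (xOf n w) (runCoins n r t m') s)
        (((tvChain n hn).claimPoly (node n) (stageDeg n) (levelO acc e n) (i + s)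
          ((tvChain n hn).pointSeq i (xOf n w) (runCoins n r t m') s)).eval 0)
        (((tvChain n hn).claimPoly (node n) (stageDeg n) (levelO acc e n) (i + s)
          ((tvChain n hn).pointSeq i (xOf n w) (runCoins n r t m') s)).eval 1) =
        ((tvChain n hn).claimPoly (node n) (stageDeg n) (levelO acc e n) (i + (s - 1))
          ((tvChain n hn).pointSeq i (xOf n w) (runCoins n r t m') (s - 1))).eval (runCoins n r t m' (s - 1)))] := by
  obtain ⟨h1, h2, -⟩ := conj_tests w r e n i m' (pre n + mlen n - i) (modStr (Mof n)) t s
  rw [conjS, iteFn_apply h1, decide_eq_true hs, if_pos rfl, iteFn_apply h2, decide_eq_false (by omega : s ≠ 0), if_neg Bool.false_ne_true,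
    Function.comp_apply, fanoutFn_apply, ES_apply hn acc hw r e him hs hr, prevS_apply hn acc hw r e him hr hs1 hs.le, eqPairFn_boolPair]
  simp only [(bits_injective (Mof n)).eq_iff]

include hn hw him hr in
/-- **The last conjunct, `s = m' ≥ 1`**: `[matrix(x_{m'}) = q_{m'-1}(ρ_{m'-1})]`. [cite: LundEtAl1992, §3] -/
theorem conjS_apply_last (hm : 1 ≤ m') :
    conjS acc (stRec (coreRec w r e n i m' (pre n + mlen n - i) (modStr (Mof n))) t m') =
      [decide (MvPolynomial.eval ((tvChain n hn).pointSeq i (xOf n w) (runCoins n r t m') m') (matrixPoly (K n) n) =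
        ((tvChain n hn).claimPoly (node n) (stageDeg n) (levelO acc e n) (i + (m' - 1))
          ((tvChain n hn).pointSeq i (xOf n w) (runCoins n r t m') (m' - 1))).eval (runCoins n r t m' (m' - 1)))] := by
  obtain ⟨h1, -, h3⟩ := conj_tests w r e n i m' (pre n + mlen n - i) (modStr (Mof n)) t m'
  rw [conjS, iteFn_apply h1, decide_eq_false (lt_irrefl m'), if_neg Bool.false_ne_true, iteFn_apply h3,
    decide_eq_false (by omega : m' ≠ 0), if_neg Bool.false_ne_true, Function.comp_apply, fanoutFn_apply,
    matS_apply hn hw r e le_rfl him.le hr, prevS_apply hn acc hw r e him hr hm le_rfl, eqPairFn_boolPair]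
  simp only [(bits_injective (Mof n)).eq_iff]

include hn hw in
/-- **The only conjunct when `m' = 0`**: bit `jOf n w` of the matrix at `xOf n w`. [cite: TrevisanVadhan2007, Lemma 4.1 (i)] -/
theorem conjS_apply_nil (him : i + 0 ≤ mlen n) :
    conjS acc (stRec (coreRec w r e n i 0 (pre n + mlen n - i) (modStr (Mof n))) t 0) =
      [goodBit n (jOf n w) (MvPolynomial.eval (xOf n w) (matrixPoly (K n) n))] := by
  obtain ⟨h1, -, h3⟩ := conj_tests w r e n i 0 (pre n + mlen n - i) (modStr (Mof n)) t 0
  rw [conjS, iteFn_apply h1, decide_eq_false (lt_irrefl 0), if_neg Bool.false_ne_true, iteFn_apply h3, decide_eq_true rfl, if_pos rfl]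
  have hM := matS_apply hn hw r e (Z := pre n + mlen n - i) (t := t) (le_refl 0) him (by simp)
  simp only [ChainCheck.Chain.pointSeq_zero] at hM
  exact bitAtS_apply w r e n i 0 _ t 0 hM

end ConjValues

/-! ### One run: the conjunction over the stages -/

/-- `allBelow k b`: all of `b 0, …, b (k-1)` hold. [folklore] -/
def allBelow (k : ℕ) (b : ℕ → Bool) : Bool := (List.range k).all b

/-- `allBelow` as a bounded quantifier. [folklore] -/
theorem allBelow_eq_true_iff (k : ℕ) (b : ℕ → Bool) : allBelow k b = true ↔ ∀ s < k, b s = true := by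
  simp [allBelow, List.all_eq_true, List.mem_range]

/-- One more index. [folklore] -/
theorem allBelow_succ (k : ℕ) (b : ℕ → Bool) : allBelow (k + 1) b = (allBelow k b && b k) := by
  simp [allBelow, List.range_succ, List.all_append]

/-- Congruence of `allBelow` below the bound. [folklore] -/
theorem allBelow_congr {k : ℕ} {b b' : ℕ → Bool} (h : ∀ s < k, b s = b' s) : allBelow k b = allBelow k b' := by
  induction k with
  | zero => rfl
  | succ k ih =>
    rw [allBelow_succ, allBelow_succ, ih (fun s hs => h s (Nat.lt_succ_of_lt hs)), h k (Nat.lt_succ_self k)]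

/-- **The conjunction fold**: with one-bit pieces `g s = [b s]`, `andOpF` folds `[true]` into
`[allBelow k b]`. [folklore] -/
theorem foldAcc_andOpF {g : List Bool → List Bool} {x : List Bool} {b : ℕ → Bool} (hg : ∀ s, g (boolPair x (ones s)) = [b s]) :
    ∀ k, foldAcc andOpF g x 0 k [true] = [allBelow k b]
  | 0 => by simp [allBelow]
  | k + 1 => by
    rw [foldAcc_succ', foldAcc_andOpF hg k, Nat.zero_add, hg k, andOpF_apply, fstF_boolPair, sndF_boolPair, allBelow_succ]
    rfl

/-- Repacking the piece argument `⟨⟨core, 1ᵗ⟩, 1ˢ⟩` of the run fold into the stage record. [folklore] -/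
def repackS : List Bool → List Bool := fanoutFn (fstF ∘ fstF) (fanoutFn (sndF ∘ fstF) sndF)

/-- `repackS ∈ FP`. [folklore] -/
theorem repackS_mem_FP : repackS ∈ FP :=
  fanoutFn_mem_FP (comp_mem_FP fstF_mem_FP fstF_mem_FP) (fanoutFn_mem_FP (comp_mem_FP sndF_mem_FP fstF_mem_FP) sndF_mem_FP)

/-- Value of `repackS`. [folklore] -/
theorem repackS_apply (core : List Bool) (t s : ℕ) : repackS (boolPair (boolPair core (ones t)) (ones s)) = stRec core t s := by
  simp [repackS, stRec]

/-- Initialisation of the run fold: `⟨x, ⟨encodeNat (m' + 1), ⟨1⁰, [1]⟩⟩⟩` on `x = ⟨core, 1ᵗ⟩`. [folklore] -/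
def initRun : List Bool → List Bool :=
  fanoutFn (fun z => z) (fanoutFn (lenBinF ∘ List.cons true ∘ qM) (fun _ => boolPair [] [true]))

/-- `initRun ∈ FP`. [folklore] -/
theorem initRun_mem_FP : initRun ∈ FP :=
  fanoutFn_mem_FP (PolyTimeComputable.id _) (fanoutFn_mem_FP (comp_mem_FP lenBinF_mem_FP (comp_mem_FP (cons_mem_FP true)
    q_mem_FP.2.2.2.2.2.1)) (const_mem_FP _))

/-- Value of `initRun`. [folklore] -/
theorem initRun_apply (w r e : List Bool) (n i m' Z : ℕ) (f : List Bool) (t : ℕ) :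
    initRun (boolPair (coreRec w r e n i m' Z f) (ones t)) =
      boolPair (boolPair (coreRec w r e n i m' Z f) (ones t)) (boolPair (encodeNat (m' + 1)) (boolPair (ones 0) [true])) := by
  have hM : qM (boolPair (coreRec w r e n i m' Z f) (ones t)) = ones m' := by simp [qM, coreRec, nthF]
  simp only [initRun, fanoutFn_apply, Function.comp_apply, hM, lenBinF_apply, List.length_cons, ones, List.length_replicate]
  rfl

/-- **The run brick**: the conjunction of the `m' + 1` stage conjuncts of run `t`, on `⟨core, 1ᵗ⟩`. [cite: LundEtAl1992, §3] [cite: Santhanam2009, Lemma 12] -/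
def runF (acc : List Bool → List Bool) : List Bool → List Bool :=
  sndPow 2 ∘ foldLoop andOpF (clipF 1 (conjS acc ∘ repackS)) X ∘ initRun

/-- `runF acc ∈ FP` for `acc ∈ FP`. [folklore] -/
theorem runF_mem_FP {acc : List Bool → List Bool} (hacc : acc ∈ FP) : runF acc ∈ FP :=
  comp_mem_FP (sndPow_mem_FP 2) (comp_mem_FP (foldLoop_clipF_mem_FP 1 andOpF_mem_FP length_andOpF_le
    (comp_mem_FP (conjS_mem_FP hacc) repackS_mem_FP) _) initRun_mem_FP)

/-- **Value of the run brick**: `[∀ s ≤ m', conjunct s]`. [cite: LundEtAl1992, §3] -/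
theorem runF_apply (acc : List Bool → List Bool) (w r e : List Bool) (n i m' Z : ℕ) (f : List Bool) (t : ℕ) :
    runF acc (boolPair (coreRec w r e n i m' Z f) (ones t)) =
      [allBelow (m' + 1) fun s => (conjS acc (stRec (coreRec w r e n i m' Z f) t s)).headD false] := by
  set x := boolPair (coreRec w r e n i m' Z f) (ones t) with hx
  have hk : m' + 1 ≤ (X : Polynomial ℕ).eval x.length := by
    simp only [eval_X, hx, coreRec, length_boolPair, ones, List.length_replicate]; omega
  have hpiece : ∀ s', (conjS acc ∘ repackS) (boolPair x (ones s')) = [(conjS acc (stRec (coreRec w r e n i m' Z f) t s')).headD false] := by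
    intro s'
    obtain ⟨b, hb⟩ := oneBit_conjS acc (stRec (coreRec w r e n i m' Z f) t s')
    rw [Function.comp_apply, hx, repackS_apply, hb]; rfl
  rw [runF, Function.comp_apply, Function.comp_apply, initRun_apply, foldLoop_apply _ _ hk, sndPow_succ_boolPair, sndPow_succ_boolPair,
    sndPow_zero_boolPair, foldAcc_clipF (fun s' _ _ => by rw [hpiece]; simp), foldAcc_andOpF hpiece]

/-- `runF acc` is one-bit on run records. [folklore] -/
theorem runF_headD (acc : List Bool → List Bool) (w r e : List Bool) (n i m' Z : ℕ) (f : List Bool) (t : ℕ) :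
    runF acc (boolPair (coreRec w r e n i m' Z f) (ones t)) = [(runF acc (boolPair (coreRec w r e n i m' Z f) (ones t))).headD false] := by
  rw [runF_apply]; rfl

/-! ### Sixty-four runs: the verdict on the core record -/

/-- Initialisation of the repetition fold: `⟨core, ⟨encodeNat 64, ⟨1⁰, [1]⟩⟩⟩`. [folklore] -/
def initCore : List Bool → List Bool := fanoutFn (fun z => z) (fun _ => boolPair (encodeNat 64) (boolPair [] [true]))

/-- `initCore ∈ FP`. [folklore] -/
theorem initCore_mem_FP : initCore ∈ FP := fanoutFn_mem_FP (PolyTimeComputable.id _) (const_mem_FP _)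

/-- **The core verdict brick**: the conjunction of the `64` runs (round budget `|core| + 64`). [cite: Santhanam2009, Lemma 12 (3)] [cite: AroraBarakCC2009, §7.4.1 (repetition)] -/
def chkCoreF (acc : List Bool → List Bool) : List Bool → List Bool :=
  sndPow 2 ∘ foldLoop andOpF (clipF 1 (runF acc)) (X + 64) ∘ initCore

/-- **`chkCoreF acc ∈ FP` for `acc ∈ FP`.** [folklore] -/
theorem chkCoreF_mem_FP {acc : List Bool → List Bool} (hacc : acc ∈ FP) : chkCoreF acc ∈ FP :=
  comp_mem_FP (sndPow_mem_FP 2) (comp_mem_FP (foldLoop_clipF_mem_FP 1 andOpF_mem_FP length_andOpF_le (runF_mem_FP hacc) _)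
    initCore_mem_FP)

/-- **Value of the core verdict brick**: `[∀ t < 64, ∀ s ≤ m', conjunct t s]`. [folklore] -/
theorem chkCoreF_eq (acc : List Bool → List Bool) (w r e : List Bool) (n i m' Z : ℕ) (f : List Bool) :
    chkCoreF acc (coreRec w r e n i m' Z f) =
      [allBelow 64 fun t => allBelow (m' + 1) fun s => (conjS acc (stRec (coreRec w r e n i m' Z f) t s)).headD false] := by
  set x := coreRec w r e n i m' Z f with hx
  have hk : 64 ≤ (X + 64 : Polynomial ℕ).eval x.length := by simp
  have hinit : initCore x = boolPair x (boolPair (encodeNat 64) (boolPair (ones 0) [true])) := by simp [initCore, ones]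
  have hpiece : ∀ t, runF acc (boolPair x (ones t)) =
      [allBelow (m' + 1) fun s => (conjS acc (stRec (coreRec w r e n i m' Z f) t s)).headD false] := fun t => by
    rw [hx, runF_apply]
  rw [chkCoreF, Function.comp_apply, Function.comp_apply, hinit, foldLoop_apply _ _ hk, sndPow_succ_boolPair, sndPow_succ_boolPair,
    sndPow_zero_boolPair, foldAcc_clipF (fun t _ _ => by rw [hpiece]; simp), foldAcc_andOpF hpiece]

/-! ### The verdict is the analysis' `checksV` -/

section Semantics

variable {n : ℕ} (hn : 0 < n) (acc : List Bool → List Bool) {w : List Bool} (hw : ptLen n ≤ w.length) (r e : List Bool)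
  {i m' : ℕ} (him : i + m' = mlen n) (hr : 64 * m' * blk n ≤ r.length)

include hn hw him hr in
/-- **One run of the machine is one run of the verifier**: the conjunction of the stage conjuncts of run
`t < 64` is the membership run `checksV` of `TVDownwardCheckerAnalysis` from stage `i` at `xOf n w`
along the challenges of run `t`, against the level oracle presented by `acc`, with `good` = "bit
`jOf n w` is `1`". [cite: LundEtAl1992, §3] [cite: Santhanam2009, Lemma 12] -/
theorem run_iff_checksOf {t : ℕ} (ht : t < 64) :
    (∀ s < m' + 1, (conjS acc (stRec (coreRec w r e n i m' (pre n + mlen n - i) (modStr (Mof n))) t s)).headD false = true) ↔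
      checksOf n hn acc e w r i m' t = true := by
  have hrt : (t * m' + m') * blk n ≤ r.length := by
    refine le_trans (Nat.mul_le_mul_right _ ?_) hr
    rw [← Nat.succ_mul]; exact Nat.mul_le_mul_right _ ht
  rcases Nat.eq_zero_or_pos m' with rfl | hm
  · -- no stage: the matrix bit
    rw [checksOf, ChainCheck.Chain.checksV]
    simp only [Nat.zero_add, Nat.lt_one_iff, forall_eq, conjS_apply_nil hn acc hw r e (i := i) (t := t) (by omega), List.headD_cons]
    rw [Nat.add_zero] at him
    show goodBit n (jOf n w) (MvPolynomial.eval (xOf n w) (matrixPoly (K n) n)) = true ↔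
      goodBit n (jOf n w) (MvPolynomial.eval (xOf n w) (fam (K n) n i)) = true
    rw [fam_of_length_le (by rw [← mlen, him])]
  · obtain ⟨j, rfl⟩ : ∃ j, m' = j + 1 := ⟨m' - 1, by omega⟩
    rw [checksOf, ChainCheck.Chain.checksV_succ_eq_true_iff]
    have hlast : ∀ y, (tvChain n hn).P (i + (j + 1)) y = MvPolynomial.eval y (matrixPoly (K n) n) := by
      intro y
      show MvPolynomial.eval y (fam (K n) n (i + (j + 1))) = _
      rw [fam_of_length_le (by rw [← mlen, him])]
    constructor
    · intro hall
      refine ⟨?_, fun s hs1 hs2 => ?_, ?_⟩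
      · have h0 := hall 0 (Nat.succ_pos _)
        rwa [conjS_apply_zero hn acc hw r e him hrt hm, List.headD_cons] at h0
      · have h1 := hall s (Nat.lt_succ_of_lt hs2)
        rwa [conjS_apply_mid hn acc hw r e him hrt hs1 hs2, List.headD_cons, decide_eq_true_eq] at h1
      · have h2 := hall (j + 1) (Nat.lt_succ_self _)
        rw [conjS_apply_last hn acc hw r e him hrt hm, List.headD_cons, decide_eq_true_eq, Nat.add_sub_cancel] at h2
        rw [hlast]; exact h2
    · rintro ⟨h0, h1, h2⟩ s hs
      rcases Nat.eq_zero_or_pos s with rfl | hs1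
      · rw [conjS_apply_zero hn acc hw r e him hrt hm, List.headD_cons]; exact h0
      · rcases Nat.lt_succ_iff_lt_or_eq.1 hs with hs2 | rfl
        · rw [conjS_apply_mid hn acc hw r e him hrt hs1 hs2, List.headD_cons, decide_eq_true_eq]; exact h1 s hs1 hs2
        · rw [conjS_apply_last hn acc hw r e him hrt hm, List.headD_cons, decide_eq_true_eq, Nat.add_sub_cancel]
          rw [hlast] at h2; exact h2

include hn hw him hr in
/-- **The verdict of the machine on the core record is the verifier's verdict, sixty-four times.**
[cite: Santhanam2009, Lemma 12] [cite: LundEtAl1992, §3] -/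
theorem chkCoreF_apply :
    chkCoreF acc (coreRec w r e n i m' (pre n + mlen n - i) (modStr (Mof n))) =
      [allBelow 64 fun t => checksOf n hn acc e w r i m' t] := by
  rw [chkCoreF_eq, allBelow_congr fun t ht => ?_]
  rw [Bool.eq_iff_iff, allBelow_eq_true_iff]
  exact run_iff_checksOf hn acc hw r e him hr ht

end Semantics

end TVChk

end Literature.Computability.Complexity

end
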